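import Summits.QuantumFields.YangMills.Theorems.BalabanUVNodesN06L3131HLegAtPinsPhysPU
import Summits.QuantumFields.YangMills.Theorems.BalabanUVNodesN06WELegAtPinsPhysPUB
import Literature.MathematicalPhysics.QuantumFieldTheory.Balaban1983to89.B9SmoothHolderClassStateProducers
import Literature.MathematicalPhysics.QuantumFieldTheory.Balaban1983to89.B9SmoothHolderClassStateDominated
import Literature.MathematicalPhysics.QuantumFieldTheory.Balaban1983to89.B9Thm312WholeStepDirRegular
import Literature.MathematicalPhysics.QuantumFieldTheory.Balaban1983to89.B9Thm313WholeDelta2LettersAtStatePrint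
import Literature.MathematicalPhysics.QuantumFieldTheory.Balaban1983to89.B9Thm312WholeStepRegular
import Literature.MathematicalPhysics.QuantumFieldTheory.Balaban1983to89.B9MultiscaleSmoothPartitionYNear

import Literature.MathematicalPhysics.QuantumFieldTheory.Balaban1983to89.B9SmoothHolderClassPClosure
import Literature.MathematicalPhysics.QuantumFieldTheory.Balaban1983to89.B9HolderProbesKAFromGradSrc
import Literature.MathematicalPhysics.QuantumFieldTheory.Balaban1983to89.B9BlockNormClassTransfer
import Literature.MathematicalPhysics.QuantumFieldTheory.Balaban1983to89.B9CoReadingCoordsInputLoc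
import Literature.MathematicalPhysics.QuantumFieldTheory.Balaban1983to89.B9CoReadingCoordsInputSLoc
import Literature.MathematicalPhysics.QuantumFieldTheory.Balaban1983to89.B9DivViaGradLettersAtPins
import Literature.MathematicalPhysics.QuantumFieldTheory.Balaban1983to89.B9Thm313WholeDirInputBC
import Literature.MathematicalPhysics.QuantumFieldTheory.Balaban1983to89.B9CarrierBlockMultiplicity
import Literature.MathematicalPhysics.QuantumFieldTheory.Balaban1983to89.B9Thm312WholeStepDirFrom3131
import Literature.MathematicalPhysics.QuantumFieldTheory.Balaban1983to89.B9Thm313WholeHolder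
import Literature.MathematicalPhysics.QuantumFieldTheory.Balaban1983to89.B9LettersHZAtOne
/-!
# N06 [B9] — THE PRODUCERS INTO THE STATE CLASSES AT THE PINS, PART B — VARIANT `D` (U8 STEP 2b): the twin of `…StateProducersBAtPinsPU` whose (3.44)-type gradient words
# `∇_{U,ν}G₀∇_U : bHW ε → (blocks)` enter as a PLAIN DISPLAYED FAMILY `hdgDvd` instead of the `Letters313IML` record (whose `θv` letter is α₀-dependent in the certificate)

T. Bałaban, *Propagators for lattice gauge theories in a background field*, Commun. Math. Phys. **99** (1985) 389–434 [`Balaban1985BackgroundPropagators`, "B9"], Thm 3.3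
p. 399 with (3.42)–(3.44) pp. 397–398, p. 423; [4] = T. Bałaban, *Propagators and renormalization transformations for lattice gauge theories. II*, Commun. Math. Phys.
**96** (1984) 223–250 [`Balaban1984PropagatorsII`], (2.51)–(2.54) pp. 232–233, Lemma 2.1 (2.60)–(2.61) p. 234.

WHY (director-ym №272 (5) ∕ №285, FLAG №8 (U8); dag-n06-l P-U8S).  The row-21 S-leaf's `hstate1` asks, for EVERY `ε > 0`, the producers `G₀∇*_{U,μ} : bHX ε → 𝔖₁` (`A_I ε`) and
`G₀D_U : bHW U ε → 𝔖₁` (`A_V ε`) INTO the (P1′) pin class `𝔖₁ = bXH x U = bHZKPG (taxiB U) wX`, out of the certificate's INPUT norms `bHX := fun ε => bHK x.toKIdx (bI x) ε`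
(bond) ∕ `bHW := fun ε => bHS x.toKIdx (sIK (bI x)) ε` (site).  dag-n06-l g27's `B9HolderProbesKAFromGradSrc.hasMaj_into_bHZKPG_of_sup_grad` lands ANY operator there from a
`𝔠^{(−1)}` sup member and `𝔠⁽⁰⁾` gradient members read OUT OF the source class; its §4 instance for `G₀∇*_{U,μ}` moves the sup word to the source via the REFUTED
localisation transfer (`hlocX`, LOCATED-S1's shape) — THIS FILE uses instead dag-n06-d g9's CLASS-MULTIPLICITY TRANSFER `B9BlockNormClassTransfer.hasMaj_of_dom_classes_eq`
(`hvanish∕hle` = `B9CoReadingCoordsInputLoc.vanishX∕leX_bHK_pins`, site `…InputSLoc.vanishW∕leW_bHS_pins`; multiplicity `2(d+1)`; the carrier distance is constant on a class).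
The gradient words are print's (3.44) at `ε ≤ 1` (`Thm33G0Dir.h44m` from the G₀ layer; `Letters313IML.dgDvd` displayed); for `ε > 1` the member at `min ε 1` is carried to
`bHX ε ∕ bHW ε` by the input norms' exponent comparison (`B9DivViaGradLettersAtPins.holK_mono`; `…InputSLoc.hasMaj_bHS_of_le`, factor 3).
WHY THE VARIANT: the certificate's displayed `hLIM : Letters313IML … (fun ε => θV13 ε * (Mα₀)) …` carries an α₀-DEPENDENT letter `θv`, so it cannot instantiate the
member-uniform `hLIM` hypothesis of `…StateProducersBAtPinsPU.hProducersB_of_pinsP_geo9Y` (θv fixed outside the member quantifier); only its field `dgDvd` is used there, so this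
twin displays that field alone (`hdgDvd`), discharged in the edition by `fun x … ν ε hε hε₁ => (hLIM x …).dgDvd ν ε hε hε₁`.  Proof = the original's, verbatim otherwise.
★★★ `hProducersB_of_pinsP_geo9Y_dg` — per member above a threshold: `∀ μ ε, 0 < ε → HasMaj (bHX x ε) (bXH x U) (G₀∘Dds μ) (AI ε·e^{−δ_P d})` with the EXPLICIT function
`AI ε := L·(2(d+1)B₀ + C_X(Bi (min ε 1)) + …)·e^{δ₀(r_near+1)}` and `∀ ε, 0 < ε → HasMaj (bHW x ε) (bXH x U) (G₀∘Dv) (AV ε·e^{−δ_P d})`.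
HONEST LABEL: helper toward the U8 re-leaf; every member enters as a HYPOTHESIS of printed species ((3.42)₃∕(3.44) for G₀) or is a landed pin fact; count-neutral; N06 NOT
discharged; K1⁹ NOT closed; nothing continuum ∕ OS ∕ mass gap ∕ Clay.  Cell `pub-ymgap` (HUMAN RULING D-0062), Track A node N06 [B9], seat `pub-ymgap-dag-n06-d` (g18), 2026-08-29.
NEW file; nothing landed is modified.
-/

noncomputable section

namespace Summit.QuantumFields.YangMills.BalabanUVNodes.N06StateProducersBAtPinsPUD

open Literature.MathematicalPhysics.QuantumFieldTheory.Balaban1983to89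
open Literature.MathematicalPhysics.QuantumFieldTheory.Balaban1983to89.Node00 (FBondY IBondY SiteY CfgY SiteParY SiteOpY parSymY GpY GpPhysY BondOpY toKT)
open Literature.MathematicalPhysics.QuantumFieldTheory.Balaban1983to89.Node00.OpsYSectDCoords (DvcoKH DvscoKH TpicoK T2coK cR39_trBasis_pos)
open B9Thm39ReadingCoords (cR39)
open B9Thm34Ext (toB6)
open B11SectG (HasMaj BlockNorm RowSum)
open B9Thm312Whole (cNorm GeoOK)
open B9Thm312WholeClasses (cNormR rwt rwt_nonneg cNormR_loc)
open B9RWSums343to347Whole (Facts347)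
open B9CoReadingCoords (XBK blkBK)
open B9CoReadingCoordsS (XSK sIK blkSK GcoS)
open B9CoReadingCoordsH (XHK)
open B9CoReadingCoordsTranspose (TrIdx trBasis)
open B9PinMembersKLevelV1 (MemberY geo9Y)
open B9BackgroundsKLevelV1R (RegFamY bg9YR MemOfFam)
open B9GeoLemma21KLevelV1 (geo9Y_len_pos geo9Y_dist_triangle geo9Y_dist_comm rowSum261_geo9Y)
open B9GeoNormsKLevelV1 (geo9K geo9K_dist_nonneg)
open B7Prop2SpecialUnitary (specialUnitaryUnits)
open B9PerturbationMajorantAlgebra (Proj349Maj Thm31GpMaj hasMaj_weaken)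
open B9PerturbationMajorantsAtLetters (PcoK)
open B9MultiscaleSmoothPartitionYNear (rNear dist_sIK_le_of_nearY)
open B9SmoothHolderClassP (bHZKP bHZKPG bHZPG)
open B9GradViaDivLettersTransported (taxiB taxiS)
open B9PerturbationSplitAtLetters (TaLcoK TbLcoKH Ta2LcoK Tb2LcoKH tpi_t2_splitL_of_pins)
open B9PerturbationL2Delta2 (D2coK)
open B9SmoothHolderClassPProducers (CTel CTel_nonneg CTel_mono CTel_mul)
open B9SmoothHolderClassTClosure (abs_cf_eq_nKT)
open B9RWSums347DefiniteFaces (geo9Y_scalars exp261 facts347_exp261_geo9Y)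
open B9RowSum261DefiniteFaces (rowConst261 rowConst261_nonneg rowConst261_spec_of_rowSum261)
open B9SectDSup (weightNorm)
open B6RandomWalk (HasMajorant)
open B9Thm312WholeStepRegular (LettersS3131)
open B9Thm313WholeDelta2LettersAtStatePrint (ta2S_pins_print_of_h44G tb₂HS_pins_print_of_h43 hasMaj_state_of_raw_two)
open Summit.QuantumFields.YangMills.BalabanUVNodes.N06HolderPinsGradedAtRecord (links_le_one)
open B6Prop22KLevelTorusCensusEta (nKT)
open B6GlobalChartV1 (PV blkV1) open B6Ineq2142KLevelV1 (β lvl) open B6Geom246MultiLevelTorus (geomT)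
open scoped Matrix.Norms.L2Operator

open B9SmoothHolderClassState (hasMaj_id_state)
open B9SmoothHolderClassStateProducers (hasMaj_into_state_of_sup_probes)
open B9SmoothHolderClassStateDominated (exists_state_loc_le_sum)
open B9Thm312WholeStepDirRegular (readS_up)
open B9SectDSup (weightNorm_κ weightNorm_loc)
open B9CoReadingCoordsHolder (PK blkPK probeK wK w₀K)
open B9CoReadingCoordsHolderAdm (wKA holderProbesKA)
open B9RWSums343Holder (HolderProbes)
open B9MultiscaleSmoothPartitionYLip (CLip)
open Summit.QuantumFields.YangMills.BalabanUVNodes.N06WELegAtPinsPhysPUB (hκX_of_pinsP)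
open Literature.MathematicalPhysics.QuantumFieldTheory.Balaban1983to89.Node00 (parBY BondParY)

open B9SmoothHolderClassPClosure (hasMaj_into_bHZKPG_of_probeFamily)
open B9HolderProbesKAFromGradSrc (hasMaj_into_bHZKPG_of_sup_grad)
open B9BlockNormClassTransfer (hasMaj_of_dom_classes_eq)
open B9CoReadingCoordsInputLoc (vanishX_bHK_pins leX_bHK_pins)
open B9CoReadingCoordsInputSLoc (vanishW_bHS_pins leW_bHS_pins hasMaj_bHS_of_le)
open B9DivViaGradLettersAtPins (holK_mono)
open B9Thm313WholeDirInputBC (Letters313IML)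
open B9CarrierBlockMultiplicity (card_sameCarrier_le_kIdx)
open B9CoRealizesRelAtLetters (RelB dist_eq_of_relB relB_refl)
open B9CoReadingCoords (cdBₗ coordOpK)
open B9CoReadingCoordsInput (bHK)
open B9CoReadingCoordsInputS (bHS)
open B9Thm312WholeClasses (hasMaj_of_in_zero)
open B9PerturbationMajorantAlgebra (hasMaj_shift rpow_abs_eq_pow)
open B9Thm312WholeClasses (hasMaj_toR)
open B9Thm39ReadingCoords (coordBound39 basisBound39)
open B9Thm313WholeDir (Thm33G0DirR)
open B9Thm312WholeDir (Thm33G0Dir)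
open B9Thm312WholeClasses (hasMaj_cNormR_of_hasMajorantHom)
open B9Thm312WholeStepDirFrom3131 (hasMaj_probe_cNormR_of_hom)
open B9Thm313WholeHolder (hasMaj_toR_tgt)
open B9SmoothHolderClassState (hasMaj_rescale hasMaj_congr_src)
open B9LettersHZAtOne (plateau_pos)
open B11SectG (hasMaj_comp_exp)
open B9Thm312Whole (cNorm_κ)
open B6RandomWalkHom (HasMajorantHom hasMajorantHom_mono)
open B9CoReadingCoordsH (blkHK)

variable {N : ℕ} {d ℓ : ℕ} {hd : 1 ≤ d + 1} {hL : Odd (ℓ + 1) ∧ 1 < ℓ + 1} {b₀ b₁ : ℝ} {Mstar : ℕ}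

set_option maxHeartbeats 800000 in
/-- ★★★ **THE TWO ε-INDEXED PRODUCERS INTO 𝔖₁ AT THE PINS, FOR EVERY ε > 0** (module docstring), member-uniformly in `x`, for `M ≥ M_T`, `Mα₀ ≤ a₀`, U ∈ (3.35)–(3.36).
[cite: Balaban1985BackgroundPropagators, Thm 3.3 p.399, (3.42)–(3.44) pp.397–398, p.423; Balaban1984PropagatorsII, (2.51)–(2.54) pp.232–233, Lemma 2.1 (2.60)–(2.61) p.234] -/
theorem hProducersB_of_pinsP_geo9Y_dg [NeZero N] [∀ x : MemberY d ℓ hd hL b₀ b₁ Mstar, Fintype (geo9Y x).Site] [∀ x : MemberY d ℓ hd hL b₀ b₁ Mstar, DecidableRel (RelB x.toKIdx)]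
    {R₁ R₂ : RegFamY d ℓ hd hL b₀ b₁ Mstar (Matrix (Fin N) (Fin N) ℂ)} (H : MemberY d ℓ hd hL b₀ b₁ Mstar → Prop)
    (bI : ∀ x : MemberY d ℓ hd hL b₀ b₁ Mstar, FBondY x.toKIdx → IBondY x.toKIdx)
    (hlev : ∀ (x : MemberY d ℓ hd hL b₀ b₁ Mstar) (f : FBondY x.toKIdx), lvl x.hN x.D x.hk (bI x f) = (blkV1 x.hN x.D f).1.1)
    (hβ1 : ∀ (x : MemberY d ℓ hd hL b₀ b₁ Mstar) (f : FBondY x.toKIdx), (geomT x.D).dist (β x.hN x.D x.hk (bI x f)) (blkV1 x.hN x.D f) ≤ 1)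
    (hbI0 : ∀ (x : MemberY d ℓ hd hL b₀ b₁ Mstar) (f : FBondY x.toKIdx), bI x f = bI x ⟨f.src, 0⟩)
    (hGR : MemOfFam (specialUnitaryUnits (Fin N)) R₁) (c : ℝ) {M₀ a₀ : ℝ} {τ : ℝ} (hτ : 0 < τ)
    (wX : ℝ → ℝ) (hwX₀ : ∀ s, 0 ≤ wX s) (hwX₁ : ∀ s, wX s ≤ 1)
    (bXH : ∀ x : MemberY d ℓ hd hL b₀ b₁ Mstar, (bg9YR (Matrix (Fin N) (Fin N) ℂ) (specialUnitaryUnits (Fin N)) R₁ R₂ x).Cfg → BlockNorm (toB6 (geo9Y x) 1 (H x)) (XBK (TrIdx N) x.toKIdx → ℝ))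
    (hbXH : ∀ (x : MemberY d ℓ hd hL b₀ b₁ Mstar) (U : (bg9YR (Matrix (Fin N) (Fin N) ℂ) (specialUnitaryUnits (Fin N)) R₁ R₂ x).Cfg), bXH x U =
      letI : Fintype (geo9K x.toKIdx).Site := (inferInstance : Fintype (geo9Y x).Site);
      bHZKPG (κ := TrIdx N) x.toKIdx (trBasis N) (taxiB x.toKIdx (bg9YR (Matrix (Fin N) (Fin N) ℂ) (specialUnitaryUnits (Fin N)) R₁ R₂ x) (fun U => U) U) (R := (1 : ℝ)) (H := H x) wX hwX₀ hwX₁)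
    -- the two INPUT norm families of the certificate (bond `bHXA`, site `bHX`) at their pins
    (bHXA : ∀ x : MemberY d ℓ hd hL b₀ b₁ Mstar, ℝ → BlockNorm (toB6 (geo9Y x) 1 (H x)) (XBK (TrIdx N) x.toKIdx → ℝ))
    (hbHXA : ∀ x : MemberY d ℓ hd hL b₀ b₁ Mstar, bHXA x = fun ε => letI : Fintype (geo9K x.toKIdx).Site := (inferInstance : Fintype (geo9Y x).Site); bHK x.toKIdx (bI x) ε)
    (bHX : ∀ x : MemberY d ℓ hd hL b₀ b₁ Mstar, ℝ → BlockNorm (toB6 (geo9Y x) 1 (H x)) (XSK (TrIdx N) x.toKIdx → ℝ))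
    (hbHX : ∀ x : MemberY d ℓ hd hL b₀ b₁ Mstar, bHX x = fun ε => letI : Fintype (geo9K x.toKIdx).Site := (inferInstance : Fintype (geo9Y x).Site); bHS x.toKIdx (sIK x.toKIdx (bI x)) ε)
    (𝔬12 : ∀ x : MemberY d ℓ hd hL b₀ b₁ Mstar, B9Thm312Whole.Ops (geo9Y x) (bg9YR (Matrix (Fin N) (Fin N) ℂ) (specialUnitaryUnits (Fin N)) R₁ R₂ x) (XBK (TrIdx N) x.toKIdx) (XBK (TrIdx N) x.toKIdx) (XHK (TrIdx N) x.toKIdx) (XSK (TrIdx N) x.toKIdx))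
    (hblk12 : ∀ x : MemberY d ℓ hd hL b₀ b₁ Mstar, (𝔬12 x).blk = blkBK x.toKIdx (bI x))
    (hblkW12 : ∀ x : MemberY d ℓ hd hL b₀ b₁ Mstar, (𝔬12 x).blkW = blkSK x.toKIdx (sIK x.toKIdx (bI x)))
    -- the single-direction letters ∇_{U,ν} ∕ ∇*_{U,μ} (the certificate's `(𝔡A x).Dd ∕ .Dsd`), the first pinned to the coordinate derivative
    (Dd Dsd : ∀ x : MemberY d ℓ hd hL b₀ b₁ Mstar, (bg9YR (Matrix (Fin N) (Fin N) ℂ) (specialUnitaryUnits (Fin N)) R₁ R₂ x).Cfg → Fin (d + 1) → Module.End ℝ (XBK (TrIdx N) x.toKIdx → ℝ))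
    (hDd : ∀ (x : MemberY d ℓ hd hL b₀ b₁ Mstar) (U : (bg9YR (Matrix (Fin N) (Fin N) ℂ) (specialUnitaryUnits (Fin N)) R₁ R₂ x).Cfg), Dd x U = fun ν => coordOpK (trBasis N) (fun _ : Fin (d + 1) => cdBₗ x.toKIdx U ν))
    -- numerics
    {B₀ δ₀ B12₃ δ12₃ δP : ℝ} {Bi Bd : ℝ → ℝ}
    (hB₀ : 0 ≤ B₀) (hBi : ∀ ε, 0 < ε → ε ≤ 1 → 0 ≤ Bi ε) (hB12₃ : 0 ≤ B12₃) (hBd : ∀ ε, 0 < ε → ε ≤ 1 → 0 ≤ Bd ε)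
    (hδP : 0 ≤ δP) (hδP₀ : δP ≤ δ₀) (hδP₃ : δP + τ ≤ δ12₃)
    -- the words: (3.42)₃ `e2d` and (3.44) `h44m` for G₀ (the G₀ layer's `Thm33G0DirR ∕ Thm33G0Dir`), STEP 2a's sup word `hZ81`, row 21's (3.44)-type gradient words `dgDvd` (the `Letters313IML.dgDvd` field of the certificate's displayed input letters, passed as a plain family so that its α₀-dependent `θv` letter stays out of this face)
    (hDirR : ∀ x : MemberY d ℓ hd hL b₀ b₁ Mstar, M₀ ≤ (geo9Y x).M → ∀ α₀ : ℝ, 0 < α₀ → (geo9Y x).M * α₀ ≤ a₀ → ∀ U : (bg9YR (Matrix (Fin N) (Fin N) ℂ) (specialUnitaryUnits (Fin N)) R₁ R₂ x).Cfg, (bg9YR (Matrix (Fin N) (Fin N) ℂ) (specialUnitaryUnits (Fin N)) R₁ R₂ x).Reg335 c α₀ U → (bg9YR (Matrix (Fin N) (Fin N) ℂ) (specialUnitaryUnits (Fin N)) R₁ R₂ x).Reg336 c α₀ U →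
      Thm33G0DirR (𝔬12 x) (Dsd x) 1 (H x) B₀ δ₀ U)
    (hDir : ∀ x : MemberY d ℓ hd hL b₀ b₁ Mstar, M₀ ≤ (geo9Y x).M → ∀ α₀ : ℝ, 0 < α₀ → (geo9Y x).M * α₀ ≤ a₀ → ∀ U : (bg9YR (Matrix (Fin N) (Fin N) ℂ) (specialUnitaryUnits (Fin N)) R₁ R₂ x).Cfg, (bg9YR (Matrix (Fin N) (Fin N) ℂ) (specialUnitaryUnits (Fin N)) R₁ R₂ x).Reg335 c α₀ U → (bg9YR (Matrix (Fin N) (Fin N) ℂ) (specialUnitaryUnits (Fin N)) R₁ R₂ x).Reg336 c α₀ U →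
      ∀ (q : Fin (d + 1) × Fin (d + 1)) (ε : ℝ), 0 < ε → ε ≤ 1 → HasMaj (bHXA x ε) (BlockNorm.ofBlocks (toB6 (geo9Y x) 1 (H x)) (𝔬12 x).blk) (Dd x U q.1 ∘ₗ ((𝔬12 x).G0 U ∘ₗ Dsd x U q.2))
        (fun (a b : (geo9Y x).Site) => Bi ε * Real.exp (-(δ₀ * (geo9Y x).dist a b))))
    (hZ81 : ∀ x : MemberY d ℓ hd hL b₀ b₁ Mstar, M₀ ≤ (geo9Y x).M → ∀ α₀ : ℝ, 0 < α₀ → (geo9Y x).M * α₀ ≤ a₀ → ∀ U : (bg9YR (Matrix (Fin N) (Fin N) ℂ) (specialUnitaryUnits (Fin N)) R₁ R₂ x).Cfg, (bg9YR (Matrix (Fin N) (Fin N) ℂ) (specialUnitaryUnits (Fin N)) R₁ R₂ x).Reg335 c α₀ U → (bg9YR (Matrix (Fin N) (Fin N) ℂ) (specialUnitaryUnits (Fin N)) R₁ R₂ x).Reg336 c α₀ U →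
      HasMaj (cNorm 1 (H x) (𝔬12 x).blkW (fun y => (geo9Y_len_pos x y).le) 1) (cNorm 1 (H x) (𝔬12 x).blk (fun y => (geo9Y_len_pos x y).le) 2) ((𝔬12 x).G0 U ∘ₗ (𝔬12 x).Dv U)
        (fun a b => B12₃ * Real.exp (-(δ12₃ * (geo9Y x).dist a b))))
    (hdgDvd : ∀ x : MemberY d ℓ hd hL b₀ b₁ Mstar, M₀ ≤ (geo9Y x).M → ∀ α₀ : ℝ, 0 < α₀ → (geo9Y x).M * α₀ ≤ a₀ → ∀ U : (bg9YR (Matrix (Fin N) (Fin N) ℂ) (specialUnitaryUnits (Fin N)) R₁ R₂ x).Cfg, (bg9YR (Matrix (Fin N) (Fin N) ℂ) (specialUnitaryUnits (Fin N)) R₁ R₂ x).Reg335 c α₀ U → (bg9YR (Matrix (Fin N) (Fin N) ℂ) (specialUnitaryUnits (Fin N)) R₁ R₂ x).Reg336 c α₀ U →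
      ∀ (ν : Fin (d + 1)) (ε : ℝ), 0 < ε → ε ≤ 1 →
        HasMaj (bHX x ε) (BlockNorm.ofBlocks (toB6 (geo9Y x) 1 (H x)) (𝔬12 x).blk) (Dd x U ν ∘ₗ ((𝔬12 x).G0 U ∘ₗ (𝔬12 x).Dv U)) (fun (a b : (geo9Y x).Site) => Bd ε * Real.exp (-(δ12₃ * (geo9Y x).dist a b)))) :
    ∃ MT : ℝ, ∀ x : MemberY d ℓ hd hL b₀ b₁ Mstar, MT ≤ (geo9Y x).M → ∀ α₀ : ℝ, 0 < α₀ → (geo9Y x).M * α₀ ≤ a₀ → ∀ U : (bg9YR (Matrix (Fin N) (Fin N) ℂ) (specialUnitaryUnits (Fin N)) R₁ R₂ x).Cfg, (bg9YR (Matrix (Fin N) (Fin N) ℂ) (specialUnitaryUnits (Fin N)) R₁ R₂ x).Reg335 c α₀ U → (bg9YR (Matrix (Fin N) (Fin N) ℂ) (specialUnitaryUnits (Fin N)) R₁ R₂ x).Reg336 c α₀ U →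
      (∀ (μ : Fin (d + 1)) (ε : ℝ), 0 < ε → HasMaj (bHXA x ε) (bXH x U) ((𝔬12 x).G0 U ∘ₗ Dsd x U μ)
          (fun a b => ((ℓ + 1 : ℕ) : ℝ) * (((2 * (d + 1) : ℕ) : ℝ) * B₀ + (coordBound39 (trBasis N) * ((d : ℝ) + 1) * basisBound39 (trBasis N) * Bi (min ε 1) * Real.exp (δ₀ * (((d : ℝ) + 1) * (((ℓ : ℝ) + 1) + 1) + 2)) +
            ((2 * (d + 1) : ℕ) : ℝ) * B₀ + coordBound39 (trBasis N) * basisBound39 (trBasis N) * (((2 * (d + 1) : ℕ) : ℝ) * B₀))) * Real.exp (δ₀ * (rNear d ℓ + 1)) * Real.exp (-(δP * (geo9Y x).dist a b)))) ∧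
      (∀ ε : ℝ, 0 < ε → HasMaj (bHX x ε) (bXH x U) ((𝔬12 x).G0 U ∘ₗ (𝔬12 x).Dv U)
          (fun a b => 3 * (((ℓ + 1 : ℕ) : ℝ) * (((2 * (d + 1) : ℕ) : ℝ) * (B12₃ * (((ℓ + 1 : ℕ) : ℝ))) + (coordBound39 (trBasis N) * ((d : ℝ) + 1) * basisBound39 (trBasis N) * Bd (min ε 1) * Real.exp ((δ12₃ - τ) * (((d : ℝ) + 1) * (((ℓ : ℝ) + 1) + 1) + 2)) +
            ((2 * (d + 1) : ℕ) : ℝ) * (B12₃ * (((ℓ + 1 : ℕ) : ℝ))) + coordBound39 (trBasis N) * basisBound39 (trBasis N) * (((2 * (d + 1) : ℕ) : ℝ) * (B12₃ * (((ℓ + 1 : ℕ) : ℝ)))))) * Real.exp ((δ12₃ - τ) * (rNear d ℓ + 1))) * Real.exp (-(δP * (geo9Y x).dist a b)))) := by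
  obtain ⟨Mg, hFa⟩ := facts347_exp261_geo9Y (d := d) (ℓ := ℓ) (hd := hd) (hL := hL) (b₀ := b₀) (b₁ := b₁) (Mstar := Mstar) H (α := 1 / 2) (δ := 2 * τ)
    (by norm_num) (by norm_num) (by linarith)
  have hτe : (1 : ℝ) / 2 * (2 * τ) = τ := by ring
  refine ⟨max M₀ Mg, fun x hM α₀ hα ha U hU hU' => ?_⟩
  letI : Fintype (geo9K x.toKIdx).Site := (inferInstance : Fintype (geo9Y x).Site)
  have hM0 : M₀ ≤ (geo9Y x).M := (le_max_left _ _).trans hM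
  have hFax := hFa x ((le_max_right _ _).trans hM)
  have hG : GeoOK (geo9Y x) := ⟨geo9Y_dist_triangle x, geo9Y_dist_comm x, geo9K_dist_nonneg x.toKIdx, geo9Y_len_pos x⟩
  have hcf := abs_cf_eq_nKT x.toKIdx x.hcfk
  have hUl := links_le_one hGR x hU
  have hLx : (geo9Y x).L ≤ (((ℓ + 1 : ℕ) : ℝ)) := (geo9Y_scalars x).2.1
  have hL0 : 0 ≤ (geo9Y x).L := le_trans zero_le_one hFax.one_le_L
  have hδ₀0 : 0 ≤ δ₀ := hδP.trans hδP₀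
  have hcB : 0 ≤ coordBound39 (trBasis N) := by unfold coordBound39; exact norm_nonneg _
  have hbB : 0 ≤ basisBound39 (trBasis N) := Finset.sum_nonneg fun _ _ => norm_nonneg _
  have hm0 : (0 : ℝ) ≤ ((2 * (d + 1) : ℕ) : ℝ) := Nat.cast_nonneg _
  -- the class data: multiplicity and the constancy of the carrier distance on classes
  have hmult : ∀ y' : (geo9Y x).Site, ((Finset.univ.filter (fun y'' : (geo9Y x).Site => RelB x.toKIdx y'' y')).card : ℝ) ≤ ((2 * (d + 1) : ℕ) : ℝ) := fun y' => by
    refine Nat.cast_le.mpr (le_trans (Finset.card_le_card fun e he => ?_) (card_sameCarrier_le_kIdx x.toKIdx y'))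
    exact Finset.mem_filter.2 ⟨@Finset.mem_univ _ (_) e, (Finset.mem_filter.1 he).2⟩
  have hRd : ∀ (a b b' : (geo9Y x).Site), RelB x.toKIdx b' b → (geo9Y x).dist a b' = (geo9Y x).dist a b := fun a b b' h => by
    rw [geo9Y_dist_comm x a b', geo9Y_dist_comm x a b]; exact dist_eq_of_relB x.toKIdx h (relB_refl x.toKIdx a)
  have hDirRx := hDirR x hM0 α₀ hα ha U hU hU'
  have hDirx := hDir x hM0 α₀ hα ha U hU hU'
  have hLIMx := hdgDvd x hM0 α₀ hα ha U hU hU'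
  refine ⟨fun μ ε hε => ?_, fun ε hε => ?_⟩
  · -- (P3) G₀∇*_{U,μ} out of bHK ε
    set ε' : ℝ := min ε 1 with hε'
    have hε'0 : 0 < ε' := lt_min hε one_pos
    have hε'1 : ε' ≤ 1 := min_le_right _ _
    have hε'ε : ε' ≤ ε := min_le_left _ _
    -- the sup word at the fibre class, then at the input class (class-multiplicity transfer)
    have he2d := hDirRx.e2d μ
    rw [hblk12 x] at he2d
    have hG1 : HasMaj (cNormR 1 (H x) (blkBK x.toKIdx (bI x)) hG.lenle 0) (cNormR 1 (H x) (blkBK x.toKIdx (bI x)) hG.lenle (-1)) ((𝔬12 x).G0 U ∘ₗ Dsd x U μ)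
        (fun a a' => B₀ * Real.exp (-(δ₀ * (geo9Y x).dist a a'))) :=
      hasMaj_cNormR_of_hasMajorantHom hG (C := fun a a' => B₀ * Real.exp (-(δ₀ * (geo9Y x).dist a a')))
        (fun a a' => mul_nonneg hB₀ (Real.exp_nonneg _)) 1 0
        (hasMajorantHom_mono (g := toB6 (geo9Y x) 1 (H x)) _ _ he2d fun a a' =>
          le_of_eq (by simp only [Real.rpow_zero, Real.rpow_one, mul_one]; ring))
    have hsup1 : HasMaj (bHK (κ := TrIdx N) x.toKIdx (bI x) ε' (R := (1 : ℝ)) (H := H x)) (cNormR 1 (H x) (blkBK x.toKIdx (bI x)) hG.lenle (-1)) ((𝔬12 x).G0 U ∘ₗ Dsd x U μ)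
        (fun a a' => ((2 * (d + 1) : ℕ) : ℝ) * (B₀ * Real.exp (-(δ₀ * (geo9Y x).dist a a')))) :=
      hasMaj_of_dom_classes_eq (b₁ := BlockNorm.ofBlocks (toB6 (geo9Y x) 1 (H x)) (blkBK x.toKIdx (bI x)))
        (b₁' := bHK (κ := TrIdx N) x.toKIdx (bI x) ε' (R := (1 : ℝ)) (H := H x)) (b₂ := cNormR 1 (H x) (blkBK x.toKIdx (bI x)) hG.lenle (-1))
        (T := (𝔬12 x).G0 U ∘ₗ Dsd x U μ) (K := fun a a' => B₀ * Real.exp (-(δ₀ * (geo9Y x).dist a a'))) (m := ((2 * (d + 1) : ℕ) : ℝ))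
        (RelB x.toKIdx) (vanishX_bHK_pins x.toKIdx (bI x) ε' hε'0) (leX_bHK_pins x.toKIdx (bI x) ε' hε'0)
        (fun a b => mul_nonneg hB₀ (Real.exp_nonneg _)) (fun a b b' h => by rw [hRd a b b' h]) hmult (hasMaj_of_in_zero hG1)
    have hsup : HasMaj (bHK (κ := TrIdx N) x.toKIdx (bI x) ε' (R := (1 : ℝ)) (H := H x)) (cNormR 1 (H x) (blkBK x.toKIdx (bI x)) hG.lenle (-1)) ((𝔬12 x).G0 U ∘ₗ Dsd x U μ)
        (fun a a' => (((2 * (d + 1) : ℕ) : ℝ) * B₀) * Real.exp (-(δ₀ * (geo9Y x).dist a a'))) := hsup1.mono fun a a' => le_of_eq (by ring)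
    -- the gradient words out of the input class at ε′ ≤ 1
    have hgrad : ∀ ν : Fin (d + 1), HasMaj (bHK (κ := TrIdx N) x.toKIdx (bI x) ε' (R := (1 : ℝ)) (H := H x)) (cNormR 1 (H x) (blkBK x.toKIdx (bI x)) hG.lenle 0)
        (coordOpK (trBasis N) (fun _ : Fin (d + 1) => cdBₗ x.toKIdx U ν) ∘ₗ ((𝔬12 x).G0 U ∘ₗ Dsd x U μ)) (fun a a' => Bi ε' * Real.exp (-(δ₀ * (geo9Y x).dist a a'))) := by
      intro ν
      have h := hDirx (ν, μ) ε' hε'0 hε'1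
      rw [hbHXA x, hblk12 x, hDd x U] at h
      intro y' v hv y
      have hb := h y' v hv y
      rw [cNormR_loc, Real.rpow_zero, one_mul]
      exact hb
    have hP := hasMaj_into_bHZKPG_of_sup_grad (B := bg9YR (Matrix (Fin N) (Fin N) ℂ) (specialUnitaryUnits (Fin N)) R₁ R₂ x) (bI := bI x)
      (bS := bHK (κ := TrIdx N) x.toKIdx (bI x) ε' (R := (1 : ℝ)) (H := H x)) (T := (𝔬12 x).G0 U ∘ₗ Dsd x U μ) (C₀ := ((2 * (d + 1) : ℕ) : ℝ) * B₀) (C₁ := Bi ε') (δ := δ₀)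
      x.toKIdx (trBasis N) (fun U => U) U hG hUl (hlev x) (hβ1 x) (hbI0 x) hcf wX hwX₀ hwX₁ (mul_nonneg hm0 hB₀) (hBi ε' hε'0 hε'1) hδ₀0 hsup hgrad
    rw [← hbXH x U] at hP
    -- back to the requested exponent ε ≥ ε′ (the input norm grows with ε), and to the common rate
    have hP' : HasMaj (bHXA x ε) (bXH x U) ((𝔬12 x).G0 U ∘ₗ Dsd x U μ)
        (fun y y' => ((ℓ + 1 : ℕ) : ℝ) * (((2 * (d + 1) : ℕ) : ℝ) * B₀ + (coordBound39 (trBasis N) * ((d : ℝ) + 1) * basisBound39 (trBasis N) * Bi ε' * Real.exp (δ₀ * (((d : ℝ) + 1) * (((ℓ : ℝ) + 1) + 1) + 2)) +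
            ((2 * (d + 1) : ℕ) : ℝ) * B₀ + coordBound39 (trBasis N) * basisBound39 (trBasis N) * (((2 * (d + 1) : ℕ) : ℝ) * B₀))) * Real.exp (δ₀ * (rNear d ℓ + 1)) * Real.exp (-(δ₀ * (geo9Y x).dist y y'))) := by
      rw [hbHXA x]
      intro y' v hv y
      refine (hP y' v hv y).trans (mul_le_mul_of_nonneg_left (add_le_add le_rfl (holK_mono x.toKIdx hε'0 hε'ε y' v)) ?_)
      have := hBi ε' hε'0 hε'1
      positivity
    exact hasMaj_weaken hG (by have := hBi ε' hε'0 hε'1; positivity) le_rfl hδP₀ hP'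
  · -- (P4) G₀D_U out of bHS ε
    set ε' : ℝ := min ε 1 with hε'
    have hε'0 : 0 < ε' := lt_min hε one_pos
    have hε'1 : ε' ≤ 1 := min_le_right _ _
    have hε'ε : ε' ≤ ε := min_le_left _ _
    -- the sup word: STEP 2a's `G₀D_U : 𝔠_W⁽¹⁾ → 𝔠⁽²⁾` shifted to `𝔠_W⁽⁰⁾ → 𝔠^{(−1)}`, then out of the site input class
    have hZ := hZ81 x hM0 α₀ hα ha U hU hU'
    rw [hblk12 x, hblkW12 x] at hZ
    have hZR := hasMaj_toR hG hZ
    rw [Nat.cast_one, Nat.cast_ofNat] at hZR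
    have hZ1 := hasMaj_shift hG hFax (1 : ℝ) (by norm_num) hB12₃ hZR
    rw [rpow_abs_eq_pow (geo9Y x).L 1 1 (by norm_num), pow_one, hτe, show (-1 : ℝ) + 1 = 0 by norm_num, show (-2 : ℝ) + 1 = -1 by norm_num] at hZ1
    have hZ1' : HasMaj (cNormR 1 (H x) (blkSK x.toKIdx (sIK x.toKIdx (bI x))) hG.lenle 0) (cNormR 1 (H x) (blkBK x.toKIdx (bI x)) hG.lenle (-1)) ((𝔬12 x).G0 U ∘ₗ (𝔬12 x).Dv U)
        (fun a b => B12₃ * (((ℓ + 1 : ℕ) : ℝ)) * Real.exp (-((δ12₃ - τ) * (geo9Y x).dist a b))) :=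
      hasMaj_weaken hG (by positivity) (by gcongr) le_rfl hZ1
    have hsup1 : HasMaj (bHS (κ := TrIdx N) x.toKIdx (sIK x.toKIdx (bI x)) ε' (R := (1 : ℝ)) (H := H x)) (cNormR 1 (H x) (blkBK x.toKIdx (bI x)) hG.lenle (-1)) ((𝔬12 x).G0 U ∘ₗ (𝔬12 x).Dv U)
        (fun a a' => ((2 * (d + 1) : ℕ) : ℝ) * (B12₃ * (((ℓ + 1 : ℕ) : ℝ)) * Real.exp (-((δ12₃ - τ) * (geo9Y x).dist a a')))) :=
      hasMaj_of_dom_classes_eq (b₁ := BlockNorm.ofBlocks (toB6 (geo9Y x) 1 (H x)) (blkSK x.toKIdx (sIK x.toKIdx (bI x))))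
        (b₁' := bHS (κ := TrIdx N) x.toKIdx (sIK x.toKIdx (bI x)) ε' (R := (1 : ℝ)) (H := H x)) (b₂ := cNormR 1 (H x) (blkBK x.toKIdx (bI x)) hG.lenle (-1))
        (T := (𝔬12 x).G0 U ∘ₗ (𝔬12 x).Dv U) (K := fun a a' => B12₃ * (((ℓ + 1 : ℕ) : ℝ)) * Real.exp (-((δ12₃ - τ) * (geo9Y x).dist a a'))) (m := ((2 * (d + 1) : ℕ) : ℝ))
        (RelB x.toKIdx) (vanishW_bHS_pins x.toKIdx (sIK x.toKIdx (bI x)) ε' hε'0) (leW_bHS_pins x.toKIdx (sIK x.toKIdx (bI x)) ε' hε'0)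
        (fun a b => by positivity) (fun a b b' h => by rw [hRd a b b' h]) hmult (hasMaj_of_in_zero hZ1')
    have hsup : HasMaj (bHS (κ := TrIdx N) x.toKIdx (sIK x.toKIdx (bI x)) ε' (R := (1 : ℝ)) (H := H x)) (cNormR 1 (H x) (blkBK x.toKIdx (bI x)) hG.lenle (-1)) ((𝔬12 x).G0 U ∘ₗ (𝔬12 x).Dv U)
        (fun a a' => (((2 * (d + 1) : ℕ) : ℝ) * (B12₃ * (((ℓ + 1 : ℕ) : ℝ)))) * Real.exp (-((δ12₃ - τ) * (geo9Y x).dist a a'))) := hsup1.mono fun a a' => le_of_eq (by ring)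
    -- the gradient words `dgDvd` at ε′ ≤ 1 out of the site input class, at the slower rate
    have hgrad : ∀ ν : Fin (d + 1), HasMaj (bHS (κ := TrIdx N) x.toKIdx (sIK x.toKIdx (bI x)) ε' (R := (1 : ℝ)) (H := H x)) (cNormR 1 (H x) (blkBK x.toKIdx (bI x)) hG.lenle 0)
        (coordOpK (trBasis N) (fun _ : Fin (d + 1) => cdBₗ x.toKIdx U ν) ∘ₗ ((𝔬12 x).G0 U ∘ₗ (𝔬12 x).Dv U)) (fun a a' => Bd ε' * Real.exp (-((δ12₃ - τ) * (geo9Y x).dist a a'))) := by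
      intro ν
      have h := hLIMx ν ε' hε'0 hε'1
      rw [hbHX x, hblk12 x, hDd x U] at h
      have h' : HasMaj (bHS (κ := TrIdx N) x.toKIdx (sIK x.toKIdx (bI x)) ε' (R := (1 : ℝ)) (H := H x)) (cNormR 1 (H x) (blkBK x.toKIdx (bI x)) hG.lenle 0)
          (coordOpK (trBasis N) (fun _ : Fin (d + 1) => cdBₗ x.toKIdx U ν) ∘ₗ ((𝔬12 x).G0 U ∘ₗ (𝔬12 x).Dv U)) (fun a a' => Bd ε' * Real.exp (-(δ12₃ * (geo9Y x).dist a a'))) := by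
        intro y' v hv y
        have hb := h y' v hv y
        rw [cNormR_loc, Real.rpow_zero, one_mul]
        exact hb
      exact hasMaj_weaken hG (hBd ε' hε'0 hε'1) le_rfl (by linarith) h'
    have hP := hasMaj_into_bHZKPG_of_sup_grad (B := bg9YR (Matrix (Fin N) (Fin N) ℂ) (specialUnitaryUnits (Fin N)) R₁ R₂ x) (bI := bI x)
      (bS := bHS (κ := TrIdx N) x.toKIdx (sIK x.toKIdx (bI x)) ε' (R := (1 : ℝ)) (H := H x)) (T := (𝔬12 x).G0 U ∘ₗ (𝔬12 x).Dv U)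
      (C₀ := ((2 * (d + 1) : ℕ) : ℝ) * (B12₃ * (((ℓ + 1 : ℕ) : ℝ)))) (C₁ := Bd ε') (δ := δ12₃ - τ)
      x.toKIdx (trBasis N) (fun U => U) U hG hUl (hlev x) (hβ1 x) (hbI0 x) hcf wX hwX₀ hwX₁ (by positivity) (hBd ε' hε'0 hε'1) (by linarith) hsup hgrad
    rw [← hbXH x U] at hP
    -- back to the requested exponent (site comparison, factor 3) and to the common rate
    have hP0 : HasMaj (bHS (κ := TrIdx N) x.toKIdx (sIK x.toKIdx (bI x)) ε' (R := (1 : ℝ)) (H := H x)) (bXH x U) ((𝔬12 x).G0 U ∘ₗ (𝔬12 x).Dv U)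
        (fun y y' => (((ℓ + 1 : ℕ) : ℝ) * (((2 * (d + 1) : ℕ) : ℝ) * (B12₃ * (((ℓ + 1 : ℕ) : ℝ))) + (coordBound39 (trBasis N) * ((d : ℝ) + 1) * basisBound39 (trBasis N) * Bd ε' * Real.exp ((δ12₃ - τ) * (((d : ℝ) + 1) * (((ℓ : ℝ) + 1) + 1) + 2)) +
            ((2 * (d + 1) : ℕ) : ℝ) * (B12₃ * (((ℓ + 1 : ℕ) : ℝ))) + coordBound39 (trBasis N) * basisBound39 (trBasis N) * (((2 * (d + 1) : ℕ) : ℝ) * (B12₃ * (((ℓ + 1 : ℕ) : ℝ)))))) * Real.exp ((δ12₃ - τ) * (rNear d ℓ + 1))) * Real.exp (-((δ12₃ - τ) * (geo9Y x).dist y y'))) := hP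
    have hP3 := hasMaj_bHS_of_le x.toKIdx (sIK x.toKIdx (bI x)) (fun _ _ => by have := hBd ε' hε'0 hε'1; positivity) hε'0 hε'ε hP0
    have e : bHX x ε = bHS (κ := TrIdx N) x.toKIdx (sIK x.toKIdx (bI x)) ε (R := (1 : ℝ)) (H := H x) := by rw [hbHX x]
    have hP' : HasMaj (bHX x ε) (bXH x U) ((𝔬12 x).G0 U ∘ₗ (𝔬12 x).Dv U)
        (fun y y' => 3 * (((ℓ + 1 : ℕ) : ℝ) * (((2 * (d + 1) : ℕ) : ℝ) * (B12₃ * (((ℓ + 1 : ℕ) : ℝ))) + (coordBound39 (trBasis N) * ((d : ℝ) + 1) * basisBound39 (trBasis N) * Bd ε' * Real.exp ((δ12₃ - τ) * (((d : ℝ) + 1) * (((ℓ : ℝ) + 1) + 1) + 2)) +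
            ((2 * (d + 1) : ℕ) : ℝ) * (B12₃ * (((ℓ + 1 : ℕ) : ℝ))) + coordBound39 (trBasis N) * basisBound39 (trBasis N) * (((2 * (d + 1) : ℕ) : ℝ) * (B12₃ * (((ℓ + 1 : ℕ) : ℝ)))))) * Real.exp ((δ12₃ - τ) * (rNear d ℓ + 1))) * Real.exp (-((δ12₃ - τ) * (geo9Y x).dist y y'))) := by
      rw [e]; exact hP3.mono fun a a' => le_of_eq (by ring)
    exact hasMaj_weaken hG (by have := hBd ε' hε'0 hε'1; positivity) le_rfl (by linarith) hP'

end Summit.QuantumFields.YangMills.BalabanUVNodes.N06StateProducersBAtPinsPUD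

end
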